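import Summits.BirchSwinnertonDyer.BirchSwinnertonDyer.Theorems.SmallImageMuTransferMuTransferX9TameClassValueInput
import Summits.BirchSwinnertonDyer.BirchSwinnertonDyer.Theorems.SmallImageMuTransferMuTransferX9KolyvaginCocycleValue
import Summits.BirchSwinnertonDyer.BirchSwinnertonDyer.Theorems.SmallImageMuTransferMuTransferX9AssemblyLocalInstances
import Summits.BirchSwinnertonDyer.BirchSwinnertonDyer.Theorems.SmallImageMuTransferMuTransferX9StepsTwoFourAssembly
import HarnessLib

/-!
# K6 crux `MuTransferX9` (stmt-BirchSwinnertonDyer-19276), skeleton v6d stub `stub_stepsTwoFourOdd`: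
# the KOLYVAGIN PACKAGE `hKoly` of the assembler (HOME/lurb/STEPS24-hKoly.lean.txt) DISCHARGED and
# the registered stub `stub_stepsTwoFourOdd` PROVED (`stub_stepsTwoFourOdd_holds`, via lur-b's assembly p472462) —
# (I0) + the Kolyvagin cocycle `c = κ_q` with `τq`, `hgen`, `hx`, `hcq`, a local Frobenius `r`, and the
# VALUE `c(res τq) = U(S)·S^{e'+1}·S^a·Φ(res r)`, `p ∤ U(0)` — from `Kato2004.IsEulerSystemClass`

Cell `bsd-smallim`, seat `bsd-smallim-koly` (gen 9).  THEOREMS ONLY.  HONEST FRAMING: helper toward the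
open stub `stub_stepsTwoFourOdd`; closes nothing.  Composition of: koly `TameClass.exists_tameCocycle_valueInput`
(p471863) and `localization_redTower_mem_unramifiedSubgroup` (p470496); x10
`KolyvaginTwist.exists_kolyvaginCocycle_value` (p469014); k6-g3 `exists_poly_unipotentPow_sub_one_eq`,
`neg_castLE_eq_shiftEnd_pow_aeval_castLE` (p451789); x9 `TameSeams.torsionGaloisModule_eq_zero_of_forall_rootsOfUnityFixer_apply_eq`
(p471231), `StepsTwoFourTransport.isSplit_and_depth_absGaloisRestrict_of_isArithFrobAt_rat` (p456302);
k6-ty tower API (`towerShift_iterate_apply_coe`, `shiftH1_iterate_oneCocycleClass`, `map_oneCocycleClass_twist`).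

References: HOME/koly/MU-TRANSFER-PROOF.md §3 Lemma 2 (INPUT, EXISTENCE, VALUES), §5 STEP 3; K. Kato,
Astérisque 295 (2004) (13.1.1), Ex. 13.3 [Kato2004Asterisque]; K. Rubin, *Euler Systems* (2000) §4.4
[Rubin2000]; L. Washington, *Introduction to Cyclotomic Fields* §13.2 [Washington1997].
-/

-- the summit and its single problem are both named `BirchSwinnertonDyer` (registry layout D-0017)
set_option linter.dupNamespace false
set_option autoImplicit false

noncomputable section

open CategoryTheory Function Finset Polynomial
open scoped NumberField Pointwise
open Field IsDedekindDomain
open Literature.NumberTheory.GaloisRepresentations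
open Literature.NumberTheory.GaloisCohomology
open Literature.NumberTheory.EllipticCurves
open Literature.NumberTheory.EllipticCurves.ZpExtension
open Literature.NumberTheory.EllipticCurves.Kato2004
open Literature.NumberTheory.EllipticCurves.Kato2004.EulerSystemValues
open Rat.HeightOneSpectrum
open Summit.BirchSwinnertonDyer.Rank1Residual.GaloisImage
open Summit.BirchSwinnertonDyer.BirchSwinnertonDyer.Rank1Residual

namespace Summit.BirchSwinnertonDyer.BirchSwinnertonDyer.Rank1Residual.TameClass

/-- `S^k ∘ V(S) = V(S) ∘ S^k` on `Fin J → M`. [cite: Washington1997, §13.1–§13.2] -/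
theorem shiftEnd_pow_aeval_apply {M : Type} [AddCommGroup M] {J : ℕ} (k : ℕ) (V : ℤ[X])
    (x : Fin J → M) :
    (shiftEnd M J ^ k) (aeval (shiftEnd M J) V x) = aeval (shiftEnd M J) V ((shiftEnd M J ^ k) x) := by
  rw [← Module.End.mul_apply, ((LocalSplitPrime.commute_aeval_self (shiftEnd M J) V).pow_left k).eq,
    Module.End.mul_apply]

variable (W : WeierstrassCurve ℚ) [W.IsElliptic] [W.IsGloballyMinimal] (p : ℕ) [Fact p.Prime]
  [ContinuousSMul ℤ_[p] (W.tateModule p)]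
  [Module.Free ℤ_[p] (W.tateModule p)] [Module.Finite ℤ_[p] (W.tateModule p)]
  (κ : ZpExtension ℚ p) (γ : absoluteGaloisGroup ℚ) (I : IwasawaH1Data W p κ γ)

/-- **The assembler's Kolyvagin package `hKoly`, discharged** (all clauses after the stub's binders,
for the producer's finite set `S₀`): (I0) the tower class `(I.redTower s)_J` is unramified at `q`, and
there are a Kolyvagin cocycle `c` of `𝒯_J`, `J = 2e'+2`, a local tame generator `τq` (its mod-`ℓ`
cyclotomic character generates), a local arithmetic Frobenius `r`, with `loc_w [c]` unramified for
`w ≠ q`, `w ∤ p`, `E[p]` unramified at `w`, `loc_q [c]` transverse, and the VALUE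
`c(res τq) = U(S)·S^{e'+1}·S^a·Φ(res r)`, `p ∤ U(0)`, `Φ` the stub's cocycle (`[Φ] = κ'_J`,
`T^{[a]} κ' = red_Ω s`).  MU-TRANSFER-PROOF Lemma 2 + (3.1) + STEP 3 on the genuine objects.
[cite: Kato2004Asterisque, §13.1 (13.1.1) and Ex. 13.3] [cite: Rubin2000, Def. 4.4.4, Lemma 4.4.2 and Thm. 4.5.1]
[cite: Washington1997, §13.1–§13.2] -/
theorem exists_kolyvaginPackage (hp2 : p ≠ 2) (hirr : W.HasIrreducibleModPGaloisRep p)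
    {s : I.H} (hES : IsEulerSystemClass W p κ γ I s) :
    ∃ S₀ : Set (HeightOneSpectrum (𝓞 ℚ)), S₀.Finite ∧
      ∀ (a : ℕ) (κ' : κ.twistTower (W.torsionGaloisModule (p : ℤ))
          (fun P : WeierstrassCurve.geomTorsion W (p : ℤ) => AddSubgroup.torsionBy.nsmul P)),
        (κ.towerShift (W.torsionGaloisModule (p : ℤ))
          (fun P : WeierstrassCurve.geomTorsion W (p : ℤ) => AddSubgroup.torsionBy.nsmul P))^[a] κ' =
            I.redTower s →
      ∀ (n e' : ℕ), e' + 1 = p ^ n →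
      ∀ (Φ : contOneCocycles (W.modPTwist p κ (2 * e' + 1 + 1)).toTopRep),
        oneCocycleClass (W.modPTwist p κ (2 * e' + 1 + 1)).toTopRep Φ = κ'.1 (2 * e' + 1 + 1) →
      ∀ (q : HeightOneSpectrum (𝓞 ℚ)), q ∉ S₀ →
      ∀ [NeZero ((primesEquiv q : Nat.Primes) : ℕ)] [Fact (((primesEquiv q : Nat.Primes) : ℕ)).Prime]
        [NeZero ((((primesEquiv q : Nat.Primes) : ℕ) : ℕ) : q.adicCompletion ℚ)]
        [(rootsOfUnityFixer ℚ ((primesEquiv q : Nat.Primes) : ℕ)).Normal]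
        [Fintype (absoluteGaloisGroup ℚ ⧸ rootsOfUnityFixer ℚ ((primesEquiv q : Nat.Primes) : ℕ))],
      ∀ 𝔓 ∈ q.primesAbove, ∀ (Fr : absoluteGaloisGroup ℚ), IsArithFrobAt (𝓞 ℚ) Fr 𝔓 →
        WeierstrassCurve.galoisRepTorsion W p Fr = 1 → Fr ∈ κ.layerSubgroup n → Fr ∉ κ.layerSubgroup (n + 1) →
      galoisCohomology.localization (W.modPTwist p κ (2 * e' + 1 + 1)) (Sum.inr q) 1
          ((I.redTower s).1 (2 * e' + 1 + 1)) ∈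
        DiscreteGaloisModule.unramifiedSubgroup (GaloisRep.toLocal q (W.modPTwist p κ (2 * e' + 1 + 1))) 1 ∧
      ∃ (c : contOneCocycles (W.modPTwist p κ (2 * e' + 1 + 1)).toTopRep)
        (τq r : absoluteGaloisGroup (q.adicCompletion ℚ)),
        τq ∈ absInertia (q.adicCompletion ℚ) ∧
        (∀ u : (ZMod ((primesEquiv q : Nat.Primes) : ℕ))ˣ,
          u ∈ Subgroup.zpowers (modPCyclotomicCharacterZMod (q.adicCompletion ℚ)
            ((primesEquiv q : Nat.Primes) : ℕ) τq)) ∧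
        (∀ w : HeightOneSpectrum (𝓞 ℚ), w ≠ q → ((p : ℕ) : 𝓞 ℚ) ∉ w.asIdeal →
          GaloisRep.IsUnramifiedAt w (W.torsionGaloisModule (p : ℤ)) →
          galoisCohomology.localization (W.modPTwist p κ (2 * e' + 1 + 1)) (Sum.inr w) 1
              (oneCocycleClass (W.modPTwist p κ (2 * e' + 1 + 1)).toTopRep c) ∈
            DiscreteGaloisModule.unramifiedSubgroup
              (GaloisRep.toLocal w (W.modPTwist p κ (2 * e' + 1 + 1))) 1) ∧
        galoisCohomology.localization (W.modPTwist p κ (2 * e' + 1 + 1)) (Sum.inr q) 1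
            (oneCocycleClass (W.modPTwist p κ (2 * e' + 1 + 1)).toTopRep c) ∈
          DiscreteGaloisModule.transverseSubgroup (GaloisRep.toLocal q (W.modPTwist p κ (2 * e' + 1 + 1)))
            (CyclotomicField ((primesEquiv q : Nat.Primes) : ℕ) (q.adicCompletion ℚ)) ∧
        IsAbsArithFrob r ∧
        ∃ U : Polynomial ℤ, ¬ ((p : ℤ) ∣ U.coeff 0) ∧
          c.1 (absGaloisRestrict ℚ (q.adicCompletion ℚ) τq) =
            Polynomial.aeval (shiftEnd (WeierstrassCurve.geomTorsion W (p : ℤ)) (2 * e' + 1 + 1)) U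
              ((shiftEnd (WeierstrassCurve.geomTorsion W (p : ℤ)) (2 * e' + 1 + 1) ^ (e' + 1))
                ((shiftEnd (WeierstrassCurve.geomTorsion W (p : ℤ)) (2 * e' + 1 + 1) ^ a)
                  (Φ.1 (absGaloisRestrict ℚ (q.adicCompletion ℚ) r)))) := by
  classical
  obtain ⟨S₀, hS₀, hmain⟩ := exists_tameCocycle_valueInput W p κ γ I hES
  refine ⟨S₀, hS₀, ?_⟩
  intro a κ' hκ' n e' he' Φ hΦ q hq _ _ _ _ _ 𝔓 h𝔓 Fr hFr hsplit hFrn hFrn'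
  have hp3 : 3 ≤ p := by
    rcases (Fact.out : p.Prime).eq_two_or_odd with h | h
    · exact absurd h hp2
    · have := (Fact.out : p.Prime).two_le; omega
  -- levels: `J = 2e'+2 = 2pⁿ ≤ L = p^(n+1)`, `J + pⁿ ≤ L`
  have hJeq : 2 * e' + 1 + 1 = 2 * p ^ n := by omega
  have hJL : 2 * e' + 1 + 1 ≤ p ^ (n + 1) := by
    rw [hJeq, pow_succ, mul_comm 2]
    exact Nat.mul_le_mul_left _ (by omega)
  have hJpL : 2 * e' + 1 + 1 + p ^ n ≤ p ^ (n + 1) := by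
    rw [hJeq, pow_succ]
    calc 2 * p ^ n + p ^ n = p ^ n * 3 := by ring
      _ ≤ p ^ n * p := Nat.mul_le_mul_left _ hp3
  obtain ⟨hqp, hunr, hdvd, u, y', hu, hact, hyI', hrel⟩ := hmain q hq h𝔓 hFr hsplit hFrn hFrn'
  refine ⟨localization_redTower_mem_unramifiedSubgroup W p κ γ I s _ hqp hunr, ?_⟩
  -- a cocycle of `𝐳̄₁` at level `L` and the norm relation
  obtain ⟨φ, hφ⟩ := oneCocycleClass_surjective _ ((I.redTower s : ∀ J : ℕ, galoisCohomology
    (κ.twistModP (W.torsionGaloisModule (p : ℤ)) IwasawaH1Data.torsion_nsmul_eq_zero J) 1)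
    (p ^ (n + 1)))
  obtain ⟨ψ', hψ', hnorm, hψJ⟩ := hrel φ hφ
  -- x10's Kolyvagin cocycle with its value
  obtain ⟨σ, hσ, τq, hτq, hτqσ, hgen, -, c, hx, hcq, r, hr, -, a', hval, hkey⟩ :=
    KolyvaginTwist.exists_kolyvaginCocycle_value κ (W.torsionGaloisModule (p : ℤ))
      IwasawaH1Data.torsion_nsmul_eq_zero (2 * e' + 1 + 1) hp2 q
      (TameSeams.torsionGaloisModule_eq_zero_of_forall_rootsOfUnityFixer_apply_eq W p hp2 hirr _)
      hqp hunr hdvd hJL y' hyI' ψ' hnorm (hψJ hJL (by omega))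
  refine ⟨c, τq, r, hτq, hgen, hx, hcq, hr, ?_⟩
  -- the key relation in `hrel` shape, then the division
  obtain ⟨V, hV0, hV⟩ := KolyvaginTwist.exists_poly_unipotentPow_sub_one_eq
    (M := WeierstrassCurve.geomTorsion W (p : ℤ)) IwasawaH1Data.torsion_nsmul_eq_zero (J := p ^ (n + 1)) n u
  have hkey' : (unipotentPow (WeierstrassCurve.geomTorsion W (p : ℤ)) (p ^ (n + 1)) (p ^ n * u) - 1) a' =
      -((unipotentPow (WeierstrassCurve.geomTorsion W (p : ℤ)) (p ^ (n + 1)) (p ^ n * u) - 1)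
        ((shiftEnd (WeierstrassCurve.geomTorsion W (p : ℤ)) (p ^ (n + 1)) ^ (p ^ n))
          (aeval (shiftEnd (WeierstrassCurve.geomTorsion W (p : ℤ)) (p ^ (n + 1))) V
            (φ.1 (absGaloisRestrict ℚ (q.adicCompletion ℚ) r))))) := by
    rw [LinearMap.sub_apply, Module.End.one_apply, ← hact r hr a', hkey, hψ']
    congr 2
    rw [hV, Module.End.mul_apply]
  have hdiv := KolyvaginTwist.neg_castLE_eq_shiftEnd_pow_aeval_castLE
    (M := WeierstrassCurve.geomTorsion W (p : ℤ)) IwasawaH1Data.torsion_nsmul_eq_zero n u hu hJpL a'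
    (φ.1 (absGaloisRestrict ℚ (q.adicCompletion ℚ) r)) (p ^ n) V hkey'
  -- `c(res τq) = S_J^{pⁿ} (V(S_J) (π (φ (res r))))`
  have hc : c.1 (absGaloisRestrict ℚ (q.adicCompletion ℚ) τq) =
      (shiftEnd (WeierstrassCurve.geomTorsion W (p : ℤ)) (2 * e' + 1 + 1) ^ (p ^ n))
        (aeval (shiftEnd (WeierstrassCurve.geomTorsion W (p : ℤ)) (2 * e' + 1 + 1)) V
          (fun i => φ.1 (absGaloisRestrict ℚ (q.adicCompletion ℚ) r) (Fin.castLE hJL i))) := by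
    rw [hval]
    exact hdiv
  -- the coboundary re-expression `π ∘ φ ∼ S^a ∘ Φ`
  have hclassJ : oneCocycleClass (κ.twistModP (W.torsionGaloisModule (p : ℤ))
        IwasawaH1Data.torsion_nsmul_eq_zero (2 * e' + 1 + 1)).toTopRep
        (κ.pushCocycle (W.torsionGaloisModule (p : ℤ)) IwasawaH1Data.torsion_nsmul_eq_zero (p ^ (n + 1))
          (κ.twistModPTruncate (W.torsionGaloisModule (p : ℤ)) IwasawaH1Data.torsion_nsmul_eq_zero
            (p ^ (n + 1)) hJL) φ) =
      oneCocycleClass (κ.twistModP (W.torsionGaloisModule (p : ℤ))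
        IwasawaH1Data.torsion_nsmul_eq_zero (2 * e' + 1 + 1)).toTopRep
        (κ.shiftPowCocycle (W.torsionGaloisModule (p : ℤ))
          (fun P : WeierstrassCurve.geomTorsion W (p : ℤ) => AddSubgroup.torsionBy.nsmul P)
          (2 * e' + 1 + 1) a Φ) := by
    have e1 := map_oneCocycleClass_twist κ (W.torsionGaloisModule (p : ℤ)) IwasawaH1Data.torsion_nsmul_eq_zero
      (p ^ (n + 1)) (κ.twistModPTruncate (W.torsionGaloisModule (p : ℤ))
        IwasawaH1Data.torsion_nsmul_eq_zero (p ^ (n + 1)) hJL) φ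
    have e2 : galoisCohomology.map (κ.twistModPTruncate (W.torsionGaloisModule (p : ℤ))
        IwasawaH1Data.torsion_nsmul_eq_zero (p ^ (n + 1)) hJL) 1
        ((I.redTower s : ∀ J : ℕ, galoisCohomology (κ.twistModP (W.torsionGaloisModule (p : ℤ))
          IwasawaH1Data.torsion_nsmul_eq_zero J) 1) (p ^ (n + 1))) =
        (I.redTower s : ∀ J : ℕ, galoisCohomology (κ.twistModP (W.torsionGaloisModule (p : ℤ))
          IwasawaH1Data.torsion_nsmul_eq_zero J) 1) (2 * e' + 1 + 1) := (I.redTower s).2 _ _ hJL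
    rw [← e1, hφ, e2, ← hκ', towerShift_iterate_apply_coe, ← hΦ]
    exact κ.shiftH1_iterate_oneCocycleClass _ _ _ a Φ
  have hdiff := hclassJ
  rw [← sub_eq_zero, ← oneCocycleClass_sub, oneCocycleClass_eq_zero_iff] at hdiff
  obtain ⟨b, hb⟩ := hdiff
  have hb' : (fun i => φ.1 (absGaloisRestrict ℚ (q.adicCompletion ℚ) r) (Fin.castLE hJL i)) =
      (shiftEnd (WeierstrassCurve.geomTorsion W (p : ℤ)) (2 * e' + 1 + 1) ^ a)
        (Φ.1 (absGaloisRestrict ℚ (q.adicCompletion ℚ) r)) +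
      (W.modPTwist p κ (2 * e' + 1 + 1) (absGaloisRestrict ℚ (q.adicCompletion ℚ) r) b - b) := by
    have h := hb (absGaloisRestrict ℚ (q.adicCompletion ℚ) r)
    rw [Submodule.coe_sub, ContinuousMap.sub_apply, ZpExtension.pushCocycle_apply, shiftPowCocycle_apply,
      sub_eq_iff_eq_add'] at h
    exact h
  -- `(res r)·b − b ∈ S^{pⁿ} 𝒯_J`
  obtain ⟨-, hρ1, hrn, -⟩ :=
    StepsTwoFourTransport.isSplit_and_depth_absGaloisRestrict_of_isArithFrobAt_rat W p κ hunr hqp h𝔓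
      hFr hsplit hFrn hFrn' hr
  obtain ⟨w, hw⟩ := κ.prime_pow_dvd_twistExponent (J := 2 * e' + 1 + 1) (by
    calc n ≤ p ^ n := (Nat.lt_pow_self (Fact.out : p.Prime).one_lt).le
      _ ≤ 2 * e' + 1 + 1 := by omega) hrn
  obtain ⟨V', -, hV'⟩ := KolyvaginTwist.exists_poly_unipotentPow_sub_one_eq
    (M := WeierstrassCurve.geomTorsion W (p : ℤ)) IwasawaH1Data.torsion_nsmul_eq_zero
    (J := 2 * e' + 1 + 1) n w
  have hcob : W.modPTwist p κ (2 * e' + 1 + 1) (absGaloisRestrict ℚ (q.adicCompletion ℚ) r) b - b =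
      (shiftEnd (WeierstrassCurve.geomTorsion W (p : ℤ)) (2 * e' + 1 + 1) ^ (p ^ n))
        (aeval (shiftEnd (WeierstrassCurve.geomTorsion W (p : ℤ)) (2 * e' + 1 + 1)) V' b) := by
    have h1 : W.modPTwist p κ (2 * e' + 1 + 1) (absGaloisRestrict ℚ (q.adicCompletion ℚ) r) b =
        unipotentPow (WeierstrassCurve.geomTorsion W (p : ℤ)) (2 * e' + 1 + 1) (p ^ n * w) b := by
      rw [WeierstrassCurve.modPTwist_apply, hw]
      congr 1
      funext i
      exact forall_smul_eq_of_galoisRepTorsion_eq_one W p hρ1 (b i)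
    rw [h1, ← Module.End.mul_apply, ← hV', LinearMap.sub_apply, Module.End.one_apply]
  -- assemble: `S^{2pⁿ} = 0` on `𝒯_J`
  have hS0 : shiftEnd (WeierstrassCurve.geomTorsion W (p : ℤ)) (2 * e' + 1 + 1) ^ (p ^ n + p ^ n) = 0 :=
    shiftEnd_pow_eq_zero (by omega)
  have hA : (shiftEnd (WeierstrassCurve.geomTorsion W (p : ℤ)) (2 * e' + 1 + 1) ^ (p ^ n))
      (aeval (shiftEnd (WeierstrassCurve.geomTorsion W (p : ℤ)) (2 * e' + 1 + 1)) V
        ((shiftEnd (WeierstrassCurve.geomTorsion W (p : ℤ)) (2 * e' + 1 + 1) ^ a)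
          (Φ.1 (absGaloisRestrict ℚ (q.adicCompletion ℚ) r)))) =
      aeval (shiftEnd (WeierstrassCurve.geomTorsion W (p : ℤ)) (2 * e' + 1 + 1)) V
        ((shiftEnd (WeierstrassCurve.geomTorsion W (p : ℤ)) (2 * e' + 1 + 1) ^ (e' + 1))
          ((shiftEnd (WeierstrassCurve.geomTorsion W (p : ℤ)) (2 * e' + 1 + 1) ^ a)
            (Φ.1 (absGaloisRestrict ℚ (q.adicCompletion ℚ) r)))) := by
    rw [shiftEnd_pow_aeval_apply, he']
  have hB : (shiftEnd (WeierstrassCurve.geomTorsion W (p : ℤ)) (2 * e' + 1 + 1) ^ (p ^ n))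
      (aeval (shiftEnd (WeierstrassCurve.geomTorsion W (p : ℤ)) (2 * e' + 1 + 1)) V
        ((shiftEnd (WeierstrassCurve.geomTorsion W (p : ℤ)) (2 * e' + 1 + 1) ^ (p ^ n))
          (aeval (shiftEnd (WeierstrassCurve.geomTorsion W (p : ℤ)) (2 * e' + 1 + 1)) V' b))) = 0 := by
    rw [← shiftEnd_pow_aeval_apply (p ^ n) V, ← Module.End.mul_apply (shiftEnd _ _ ^ (p ^ n)),
      ← pow_add, hS0, LinearMap.zero_apply]
  refine ⟨V, fun h => hu (Int.natCast_dvd_natCast.mp (hV0 ▸ h)), ?_⟩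
  rw [hc, hb', map_add, map_add, hcob, hA, hB, add_zero]


/-- **The assembler's hypothesis `hKoly` (HOME/lurb/STEPS24-hKoly.lean.txt, sha16 960563ac75c72708),
VERBATIM, discharged** by `exists_kolyvaginPackage` (the extra binders `¬Surj`, `IsCyclotomic`,
`IsTopGenerator` are not used). [cite: Kato2004Asterisque, §13.1 (13.1.1) and Ex. 13.3]
[cite: Rubin2000, Def. 4.4.4, Lemma 4.4.2 and Thm. 4.5.1] -/
theorem hKoly_holds :
    ∀ (W : WeierstrassCurve ℚ) [W.IsElliptic] [W.IsGloballyMinimal] (p : ℕ) [Fact p.Prime]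
          [ContinuousSMul ℤ_[p] (W.tateModule p)] [Module.Free ℤ_[p] (W.tateModule p)]
          [Module.Finite ℤ_[p] (W.tateModule p)] (κ : ZpExtension ℚ p) (γ : absoluteGaloisGroup ℚ)
          (I : IwasawaH1Data W p κ γ), p ≠ 2 → W.HasIrreducibleModPGaloisRep p → ¬ W.HasSurjectiveModNGaloisRep p →
          κ.IsCyclotomic → κ.IsTopGenerator γ → ∀ (s : I.H), IsEulerSystemClass W p κ γ I s →
          ∃ (S₀ : Set (HeightOneSpectrum (𝓞 ℚ))), S₀.Finite ∧
          ∀ (a : ℕ) (κ' : κ.twistTower (W.torsionGaloisModule (p : ℤ))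
              (fun P : WeierstrassCurve.geomTorsion W (p : ℤ) => AddSubgroup.torsionBy.nsmul P)),
            (κ.towerShift (W.torsionGaloisModule (p : ℤ))
              (fun P : WeierstrassCurve.geomTorsion W (p : ℤ) => AddSubgroup.torsionBy.nsmul P))^[a] κ' = I.redTower s →
          ∀ (n e' : ℕ), e' + 1 = p ^ n →
          ∀ (Φ : contOneCocycles (W.modPTwist p κ (2 * e' + 1 + 1)).toTopRep),
            oneCocycleClass (W.modPTwist p κ (2 * e' + 1 + 1)).toTopRep Φ = κ'.1 (2 * e' + 1 + 1) →
          ∀ (q : HeightOneSpectrum (𝓞 ℚ)), q ∉ S₀ →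
          ∀ [NeZero ((primesEquiv q : Nat.Primes) : ℕ)] [Fact (((primesEquiv q : Nat.Primes) : ℕ)).Prime]
            [NeZero ((((primesEquiv q : Nat.Primes) : ℕ) : ℕ) : q.adicCompletion ℚ)]
            [(rootsOfUnityFixer ℚ ((primesEquiv q : Nat.Primes) : ℕ)).Normal]
            [Fintype (absoluteGaloisGroup ℚ ⧸ rootsOfUnityFixer ℚ ((primesEquiv q : Nat.Primes) : ℕ))],
          ∀ 𝔓 ∈ q.primesAbove, ∀ (Fr : absoluteGaloisGroup ℚ), IsArithFrobAt (𝓞 ℚ) Fr 𝔓 →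
            WeierstrassCurve.galoisRepTorsion W p Fr = 1 → Fr ∈ κ.layerSubgroup n → Fr ∉ κ.layerSubgroup (n + 1) →
          -- (I0) the Euler-system tower class at level `J = 2e'+2` is unramified at `q`
          galoisCohomology.localization (W.modPTwist p κ (2 * e' + 1 + 1)) (Sum.inr q) 1
              ((I.redTower s).1 (2 * e' + 1 + 1)) ∈
            DiscreteGaloisModule.unramifiedSubgroup (GaloisRep.toLocal q (W.modPTwist p κ (2 * e' + 1 + 1))) 1 ∧
          -- the KOLYVAGIN PACKAGE at `q`: a global cocycle `c` (the Kolyvagin class `κ_q` at level `J`), a tame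
          -- generator `τq ∈ I_{ℚ_q}` read through `χ̄_ℓ`, a local arithmetic Frobenius `r`, and the VALUE identity
          ∃ (c : contOneCocycles (W.modPTwist p κ (2 * e' + 1 + 1)).toTopRep)
            (τq r : absoluteGaloisGroup (q.adicCompletion ℚ)),
            τq ∈ absInertia (q.adicCompletion ℚ) ∧
            (∀ u : (ZMod ((primesEquiv q : Nat.Primes) : ℕ))ˣ,
              u ∈ Subgroup.zpowers (modPCyclotomicCharacterZMod (q.adicCompletion ℚ)
                ((primesEquiv q : Nat.Primes) : ℕ) τq)) ∧
            (∀ w : HeightOneSpectrum (𝓞 ℚ), w ≠ q → ((p : ℕ) : 𝓞 ℚ) ∉ w.asIdeal →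
              GaloisRep.IsUnramifiedAt w (W.torsionGaloisModule (p : ℤ)) →
              galoisCohomology.localization (W.modPTwist p κ (2 * e' + 1 + 1)) (Sum.inr w) 1
                  (oneCocycleClass (W.modPTwist p κ (2 * e' + 1 + 1)).toTopRep c) ∈
                DiscreteGaloisModule.unramifiedSubgroup
                  (GaloisRep.toLocal w (W.modPTwist p κ (2 * e' + 1 + 1))) 1) ∧
            galoisCohomology.localization (W.modPTwist p κ (2 * e' + 1 + 1)) (Sum.inr q) 1
                (oneCocycleClass (W.modPTwist p κ (2 * e' + 1 + 1)).toTopRep c) ∈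
              DiscreteGaloisModule.transverseSubgroup (GaloisRep.toLocal q (W.modPTwist p κ (2 * e' + 1 + 1)))
                (CyclotomicField ((primesEquiv q : Nat.Primes) : ℕ) (q.adicCompletion ℚ)) ∧
            IsAbsArithFrob r ∧
            ∃ U : Polynomial ℤ, ¬ ((p : ℤ) ∣ U.coeff 0) ∧
              c.1 (absGaloisRestrict ℚ (q.adicCompletion ℚ) τq) =
                Polynomial.aeval (shiftEnd (WeierstrassCurve.geomTorsion W (p : ℤ)) (2 * e' + 1 + 1)) U
                  ((shiftEnd (WeierstrassCurve.geomTorsion W (p : ℤ)) (2 * e' + 1 + 1) ^ (e' + 1))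
                    ((shiftEnd (WeierstrassCurve.geomTorsion W (p : ℤ)) (2 * e' + 1 + 1) ^ a)
                      (Φ.1 (absGaloisRestrict ℚ (q.adicCompletion ℚ) r)))) :=
  fun W _ _ p _ _ _ _ κ γ I hp2 hirr _ _ _ _ hES => exists_kolyvaginPackage W p κ γ I hp2 hirr hES

/-- **THE REGISTERED STUB `stub_stepsTwoFourOdd` OF CRUX `MuTransferX9` (skeleton v6/v6d), VERBATIM**
(HOME/plan/k6/lines/v6_sig_stub_stepsTwoFourOdd.txt): MU-TRANSFER-PROOF Lemma 2 + STEPS 3–4 on the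
genuine objects — lur-b's assembly `StepsTwoFour.stub_stepsTwoFourOdd_of` (p472462) applied to
`hKoly_holds`. [cite: Kato2004Asterisque, §13.1 (13.1.1), Ex. 13.3 and §17.13]
[cite: Rubin2000, Thm. 4.5.1 and §4.4] [cite: MazurRubin2004, §5.3] -/
theorem stub_stepsTwoFourOdd_holds :
    ∀ (W : WeierstrassCurve ℚ) [W.IsElliptic] [W.IsGloballyMinimal] (p : ℕ) [Fact p.Prime] [ContinuousSMul ℤ_[p] (W.tateModule p)] [Module.Free ℤ_[p] (W.tateModule p)] [Module.Finite ℤ_[p] (W.tateModule p)] (κ : ZpExtension ℚ p) (γ : absoluteGaloisGroup ℚ) (I : IwasawaH1Data W p κ γ), p ≠ 2 → W.HasIrreducibleModPGaloisRep p → ¬ W.HasSurjectiveModNGaloisRep p → κ.IsCyclotomic → κ.IsTopGenerator γ → poitouTate_sum_localTatePairing_eq_zero ℚ → ∀ (s : I.H), IsEulerSystemClass W p κ γ I s → ∃ (S₀ : Set (HeightOneSpectrum (𝓞 ℚ))), S₀.Finite ∧ ∀ (a : ℕ) (κ' : κ.twistTower (W.torsionGaloisModule (p : ℤ)) (fun P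 : WeierstrassCurve.geomTorsion W (p : ℤ) => AddSubgroup.torsionBy.nsmul P)), (κ.towerShift (W.torsionGaloisModule (p : ℤ)) (fun P : WeierstrassCurve.geomTorsion W (p : ℤ) => AddSubgroup.torsionBy.nsmul P))^[a] κ' = I.redTower s → ∀ (n e' : ℕ), e' + 1 = p ^ n → ∀ (Φ : contOneCocycles (W.modPTwist p κ (2 * e' + 1 + 1)).toTopRep), oneCocycleClass (W.modPTwist p κ (2 * e' + 1 + 1)).toTopRep Φ = κ'.1 (2 * e' + 1 + 1) → ∀ (ε : ℕ) (S₁ : Set (HeightOneSpectrum (𝓞 ℚ))) (Ψ : galoisCohomology (W.modPTwist p κ.invTwist (2 * e' + 1 + 1)) 1) (Ψc : contOneCocycles (W.modPTwist p κ.invTwist (2 * e' + 1 + 1)).toTopRep), S₀ ⊆ S₁ → oneCocycleClass (W.modPTwist p κ.invTwist (2 * e' + 1 + 1)).toTopRep Ψc = Ψ → (∀ v : HeightOneSpectrum (𝓞 ℚ), v ∉ S₁ → galoisCohomology.localization (W.modPTwist p κ.invTwist (2 * e' + 1 + 1)) (Sum.inr v) 1 Ψ ∈ DiscreteGaloisModule.unramifiedSubgroup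 (GaloisRep.toLocal v (W.modPTwist p κ.invTwist (2 * e' + 1 + 1))) 1) → (∀ v : HeightOneSpectrum (𝓞 ℚ), v ∈ S₁ → galoisCohomology.localization (W.modPTwist p κ.invTwist (2 * e' + 1 + 1)) (Sum.inr v) 1 ((κ.invTwist.shiftH1 (W.torsionGaloisModule (p : ℤ)) (fun P : WeierstrassCurve.geomTorsion W (p : ℤ) => AddSubgroup.torsionBy.nsmul P) (2 * e' + 1 + 1))^[ε] Ψ) = 0) → ∀ (eW : WeierstrassCurve.geomTorsion W (p : ℤ) → WeierstrassCurve.geomTorsion W (p : ℤ) → AlgebraicClosure ℚ) (hμ : ∀ S T, eW S T ^ p = 1) (hadd₁ : ∀ S₁' S₂' T, eW (S₁' + S₂') T = eW S₁' T * eW S₂' T) (hadd₂ : ∀ S T₁ T₂, eW S (T₁ + T₂) = eW S T₁ * eW S T₂), (∀ T, eW T T = 1) → (∀ T, (∀ S, eW S T = 1) → T = 0) → (∀ (σ : absoluteGaloisGroup ℚ) (S T : WeierstrassCurve.geomTorsion W (p : ℤ)), σ • eW S T = eW (σ • S) (σ • T)) → ∀ (q : HeightOneSpectrum (𝓞 ℚ)),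 q ∉ S₁ → ∀ 𝔓 ∈ q.primesAbove, ∀ (Fr : absoluteGaloisGroup ℚ), IsArithFrobAt (𝓞 ℚ) Fr 𝔓 → WeierstrassCurve.galoisRepTorsion W p Fr = 1 → Fr ∈ κ.layerSubgroup n → Fr ∉ κ.layerSubgroup (n + 1) → ∃ U : Polynomial ℤ, ¬ ((p : ℤ) ∣ U.coeff 0) ∧ ∀ i : ℕ, i + ε < 2 * e' + 1 + 1 → convCoeff (weilPairingHom W p eW hμ hadd₁ hadd₂) (2 * e' + 1 + 1) i (Polynomial.aeval (shiftEnd (WeierstrassCurve.geomTorsion W (p : ℤ)) (2 * e' + 1 + 1)) U ((shiftEnd (WeierstrassCurve.geomTorsion W (p : ℤ)) (2 * e' + 1 + 1) ^ (e' + 1 + a)) (Φ.1 Fr))) (Ψc.1 Fr) = 0 :=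
  StepsTwoFour.stub_stepsTwoFourOdd_of hKoly_holds

end Summit.BirchSwinnertonDyer.BirchSwinnertonDyer.Rank1Residual.TameClass

end
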